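import Summits.RiemannHypothesis.RiemannHypothesis.Theorems.WeilFormatCArchSectorEntries
import Summits.RiemannHypothesis.RiemannHypothesis.Theorems.WeilFormatCPolarFormBound
import HarnessLib

/-!
# Format C, L-C3b (even sector): uniform closed forms of the far COLUMNS of the even kernel, zero row included

Route context: Fourier–Galerkin / Schur-complement certificates of Weil positivity on a window ("format C";
cell memo `run/shared/lean/pub/rh-explicit/rh-explicit-weil-10/FORMATC-DESIGN.md` §4.2 / §9.5; supporting
stmt-RiemannHypothesis-0098; seat rh-explicit-weil-10).  The coupling columns `b_m(i) = M⁺(i,m)` of the even SectorSplit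
kernel `M⁺(i,m) = [i=0: G(0,m) | (G(i,m)+G(i,−m))/2]` (block row `0 ≤ i`, far column `m > i`) for the three pieces of
`G = Yoshida1992.gramCoeff a` have ONE closed form valid for the zero row as well (`Y_0 = Im ψ(¼) = 0`, `T_0 = 0`,
`c_0 = 1`, `d_0 = 0`):

* `evenPolar_col_eq` — `M⁺_POL(i,m) = (4s²/a)(−1)^{i+m} c_i c_m` (`c = 1/(1+4ω²)`);
* `evenPrime_col_eq` — `M⁺_PRI(i,m) = (−1)^{i+m} Σ_k (Λ_k/√k)(m sin ω_mℓ_k − i sin ω_iℓ_k)/(π(m²−i²))`;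
* `evenArch_col_eq` — `M⁺_ARCH(i,m) = (−1)^{i+m}[(mY_m − iY_i)/(2π(m²−i²)) − (mT_m − iT_i)/(π(m²−i²))]`.

Sequel: `WeilFormatCColumnEven.lean` (the order-1 remainder `|M⁺(i,m) − (−1)^{i+m}g_m/(4m)| ≤ κ⁺(i)/m²`).
Elementary; standard axioms; no definitions; no RH claim.
-/

set_option autoImplicit false
-- `Summit.RiemannHypothesis.RiemannHypothesis.…` is the layout-mandated namespace (summit = problem name).
set_option linter.dupNamespace false

noncomputable section

open Complex Finset
open scoped Real BigOperators ArithmeticFunction.vonMangoldt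

namespace Summit.RiemannHypothesis.RiemannHypothesis.Theorems.WeilFormatC

open Literature.NumberTheory.LFunctions Literature.NumberTheory.LFunctions.Yoshida1992
open Literature.Analysis.SpecialFunctions

variable {a : ℝ}

/-! ## Values at the zero mode -/

/-- `ω_0 = 0`. -/
theorem freq_zero (a : ℝ) : freq a 0 = 0 := by unfold freq; simp

/-- `Y_0 = Im ψ(¼) = 0`. -/
theorem im_digamma_quarter_zero : (Complex.digamma (1 / 4 + ((freq a 0 : ℝ) : ℂ) / 2 * I)).im = 0 := by
  have h := im_digamma_quarter_neg (freq a 0)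
  rw [freq_zero, neg_zero] at h
  rw [freq_zero]
  linarith

/-- `T_0 = 0`. -/
theorem archExpSumSin_zero (a : ℝ) : archExpSumSin a 0 = 0 := by
  have h := archExpSumSin_neg a 0
  rw [neg_zero] at h
  linarith

/-! ## Uniform closed forms of the even columns (`0 ≤ i < m`) -/

section ClosedForms

/-- **Polar column**: `M⁺_POL(i,m) = (4s²/a)(−1)^{i+m} c_i c_m` for `0 ≤ i`, `1 ≤ m`, `i ≠ m`. -/
theorem evenPolar_col_eq (a : ℝ) {i m : ℕ} (hm : 1 ≤ m) (him : i ≠ m) :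
    (if i = 0 then polarCoeff a 0 m else if m = 0 then polarCoeff a i 0
      else (polarCoeff a i m + polarCoeff a i (-(m : ℤ))) / 2)
      = 4 / a * (Real.exp (a / 2) - Real.exp (-(a / 2))) ^ 2 * (-1 : ℝ) ^ ((i : ℤ) + m) *
          (1 / (1 + 4 * freq a i ^ 2)) * (1 / (1 + 4 * freq a m ^ 2)) := by
  by_cases hi : i = 0
  · subst hi
    rw [if_pos rfl, polarCoeff_eq_rankOne]
    simp only [Nat.cast_zero, freq_zero, zero_add, zpow_zero, one_mul, zero_div, mul_zero, zero_mul, sub_zero]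
    ring
  · rw [if_neg hi, if_neg (by omega), polarCoeff_eq_rankOne, polarCoeff_eq_rankOne, freq_neg, neg_one_zpow_neg',
      zpow_add₀ (by norm_num : (-1 : ℝ) ≠ 0)]
    ring

/-- **Prime column**: `M⁺_PRI(i,m) = (−1)^{i+m} Σ_k (Λ_k/√k)(m sin ω_mℓ_k − i sin ω_iℓ_k)/(π(m²−i²))` for `0 ≤ i < m`. -/
theorem evenPrime_col_eq (a : ℝ) {i m : ℕ} (hm : 1 ≤ m) (him : i < m) :
    (if i = 0 then primeCoeff a 0 m else if m = 0 then primeCoeff a i 0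
      else (primeCoeff a i m + primeCoeff a i (-(m : ℤ))) / 2)
      = (-1 : ℝ) ^ ((i : ℤ) + m) * ∑ k ∈ weilPrimeIndex a, (Λ k : ℝ) / Real.sqrt k *
          (((m : ℝ) * Real.sin (freq a m * Real.log k) - i * Real.sin (freq a i * Real.log k))
            / (π * ((m : ℝ) ^ 2 - i ^ 2))) := by
  have hm0 : (0 : ℝ) < m := by exact_mod_cast hm
  have hd1 : (i : ℝ) - m ≠ 0 := sub_ne_zero.mpr (by exact_mod_cast (ne_of_lt him))
  have hd1' : (m : ℝ) - i ≠ 0 := sub_ne_zero.mpr (by exact_mod_cast (ne_of_gt him))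
  have hd2 : (0 : ℝ) < (i : ℝ) + m := by positivity
  have hD : (m : ℝ) ^ 2 - i ^ 2 ≠ 0 := by rw [sq_sub_sq]; exact mul_ne_zero (by positivity) hd1'
  have h1 : (i : ℤ) ≠ m := by exact_mod_cast (ne_of_lt him)
  have h2 : (i : ℤ) ≠ -(m : ℤ) := by omega
  by_cases hi : i = 0
  · subst hi
    rw [if_pos rfl]
    unfold primeCoeff
    rw [Finset.mul_sum]
    refine Finset.sum_congr rfl fun k _ ↦ ?_
    have h0m : (0 : ℤ) ≠ m := by exact_mod_cast h1
    unfold incrCoeff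
    rw [if_neg h0m, if_neg h0m, freq_zero]
    push_cast
    simp only [zero_mul, Real.sin_zero, sub_zero, zero_add, zero_sub]
    field_simp
    ring
  · rw [if_neg hi, if_neg (by omega)]
    unfold primeCoeff
    rw [← Finset.sum_add_distrib, Finset.sum_div, Finset.mul_sum]
    refine Finset.sum_congr rfl fun k _ ↦ ?_
    unfold incrCoeff
    rw [if_neg h1, if_neg h2, if_neg h1, if_neg h2, freq_neg, neg_one_zpow_add_neg]
    push_cast
    simp only [neg_mul, Real.sin_neg, sub_neg_eq_add, sub_zero]
    have hd2' : (i : ℝ) + m ≠ 0 := hd2.ne'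
    generalize (Λ k : ℝ) / Real.sqrt k = w
    generalize Real.sin (freq a m * Real.log k) = sm
    generalize Real.sin (freq a i * Real.log k) = si
    field_simp
    ring

/-- **Archimedean column**: `M⁺_ARCH(i,m) = (−1)^{i+m}[(mY_m − iY_i)/(2π(m²−i²)) − (mT_m − iT_i)/(π(m²−i²))]`, `0 ≤ i < m`. -/
theorem evenArch_col_eq (a : ℝ) {i m : ℕ} (hm : 1 ≤ m) (him : i < m) :
    (if i = 0 then archCoeff a 0 m else if m = 0 then archCoeff a i 0
      else (archCoeff a i m + archCoeff a i (-(m : ℤ))) / 2)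
      = (-1 : ℝ) ^ ((i : ℤ) + m) *
          (((m : ℝ) * (Complex.digamma (1 / 4 + ((freq a m : ℝ) : ℂ) / 2 * I)).im
              - i * (Complex.digamma (1 / 4 + ((freq a i : ℝ) : ℂ) / 2 * I)).im) / (2 * π * ((m : ℝ) ^ 2 - i ^ 2))
            - ((m : ℝ) * archExpSumSin a m - i * archExpSumSin a i) / (π * ((m : ℝ) ^ 2 - i ^ 2))) := by
  have hm0 : (0 : ℝ) < m := by exact_mod_cast hm
  by_cases hi : i = 0
  · subst hi
    rw [if_pos rfl]
    have h0m : (0 : ℤ) ≠ m := by exact_mod_cast (ne_of_lt him)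
    have hm' : (m : ℝ) ≠ 0 := hm0.ne'
    unfold archCoeff
    rw [if_neg h0m, im_digamma_quarter_zero, archExpSumSin_zero]
    push_cast
    simp only [zero_mul, sub_zero, zero_add]
    field_simp
    ring
  · have hi1 : 1 ≤ i := by omega
    rw [if_neg hi, if_neg (by omega), evenArch_offDiag_eq a hi1 hm (ne_of_lt him)]
    have hd1' : (m : ℝ) - i ≠ 0 := sub_ne_zero.mpr (by exact_mod_cast (ne_of_gt him))
    have hD : (m : ℝ) ^ 2 - i ^ 2 ≠ 0 := by rw [sq_sub_sq]; exact mul_ne_zero (by positivity) hd1'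
    have hD' : (i : ℝ) ^ 2 - m ^ 2 ≠ 0 := by
      rw [show (i : ℝ) ^ 2 - m ^ 2 = -((m : ℝ) ^ 2 - i ^ 2) by ring]; exact neg_ne_zero.mpr hD
    field_simp
    ring

end ClosedForms

end Summit.RiemannHypothesis.RiemannHypothesis.Theorems.WeilFormatC

end
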